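import Summits.BirchSwinnertonDyer.Rank1Residual.X11b.Three.GoodReductionSubgroupNodeFrobeniusExt
import Summits.BirchSwinnertonDyer.Rank1Residual.X11b.Three.GoodReductionSubgroupTorusH1
import Summits.BirchSwinnertonDyer.Rank1Residual.X11b.Three.GoodReductionSubgroupNodeH1
import Mathlib.RingTheory.RootsOfUnity.PrimitiveRoots
import HarnessLib

/-!
# X11b at `p = 3` (team N8/O2), JET3-KUMMER (α): the `Ẽ_ns` half DISCHARGED at a NON-SPLIT
# multiplicative place whose node stays non-split over the residue field (`[k : k_v]` odd) —
# Hilbert 90 on the norm-one torus `{u ∈ k'ˣ : u^{qⁿ+1} = 1}`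

HONEST FRAMING (cell `b2b-bsdres`, run/shared/lean/b2b/bsd-rank1-residual/, verbatim in every
file): the goal of the cell is to DELETE the COMBINATION-SHAPED residual classes of the
Birch–Swinnerton-Dyer formula for ALL analytic-rank `≤ 1` elliptic curves over `ℚ` — "full BSD
formula for every rank `≤ 1` curve in class `C`" assembled STRICTLY from published theorems — so
that the rank-`≤ 1` remainder becomes exactly the CONSTRUCTION-SHAPED classes, which are TYPED
(missing-input `Prop`s), NOT attempted. This is not "finishing BSD". Team N8/O2 = `x11b3`, seat
`b2b-bsdres-x11b3-p3` (GEN 3), LEAD DEAL #6 A6.2 (2) / A6.3 (3), sub-target S15 (ii) "the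
non-split node with `[k : k_v]` odd", part 3 of 3. THEOREMS ONLY: no definition, no named fact, no `sorry`; nothing is
booked; the flag `JET@p|N` is NOT discharged; the formal-group half `h1ker` stays a NAMED STUB
(x11b3-p4, S15 (i)).

## What

x11b3-p4's `h1red_of_node` (`GoodReductionSubgroupNodeH1`) discharges the `Ẽ_ns` half of p1's
hypothesis (α) at a multiplicative place whose node is presented over the residue field `k`
(split over `K_v`; non-split with `[k : k_v]` even) and leaves the node that stays NON-split over
`k` (`[k : k_v]` odd; `Ẽ_ns(k)` = the norm-one torus of order `qⁿ + 1`, `#k = qⁿ`). This file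
covers it in p1's `JetchevKummerAtP` dictionary (`X / F`, `L ⊇ F`, `R` henselian DVR,
`Frac R = L`, `k` finite, `Aut(L/F)` preserving `R`, `φ` inducing `x ↦ x^q` on `k`), the node
being presented over a field `k' ⊇ k` along `j : k →+* k'`
(`(W₀ mod 𝔪).map j = singularModel x₀ y₀ α₁ α₂`, tree currency of `SplitNodeQuadraticProofs`)
with `α₁ ∉ j(k)`, `k'` carrying the `q`-power ring endomorphism `Fq` and a primitive
`(qⁿ + 1)`-th root of unity `ζ` (e.g. `k' = 𝔽_{q^{2n}}`, `ζ = g^{qⁿ−1}`; or `k' = k̄`):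

* `h1red_of_nonsplit_node` — **the stub `h1red` HOLDS** for `E₁ = E₁(L)`: the fixed points of
  `F = Fqⁿ` in `k'` are `j(k)` (part 2), so `F` swaps `α₁, α₂` (`singularModel.apply_eq_of_map_eq`),
  `α₁ ≠ α₂`, `Fq` swaps them, `n` is odd; the node reduction map `r : E₀(L) → k'ˣ` of part 1
  (kernel `E₁(L)`) satisfies `r(φ P) = (r P)^{−q}` and `r P = (r P)^{−qⁿ}` (part 1's Galois rule
  for `(φ, Fq)` and `(1, F)`), so lands in `T = {u : u^{qⁿ+1} = 1} = ⟨ζ⟩`, ONTO (for `u ∈ T`,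
  `Q = ψ⁻¹(u)` has `ψ(F Q) = F(ψ Q)⁻¹ = u`, so `F Q = Q` is `k`-rational and Hensel-lifts — tree
  `exists_equation_residue_eq`); and `H¹(⟨u ↦ u^{−q}⟩, T) = 0` in cyclic form since
  `(Σ_{j<n} (−q)ʲ)(−q − 1) = −(qⁿ + 1)` (part 2; p4's dévissage `h1red_of_reductionMap`).
* `hα_of_h1ker_of_nonsplit_node`, `exists_baseChange_eq_add_pow_smul_of_h1ker_of_nonsplit_node`
  — (α), resp. the end form `T ∈ E₀(K_v) + p^m E(K_v)`, from the formal-group stub `h1ker`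
  ALONE at such a place (companions of p4's `…_of_node` corollaries). With p4's `h1red_of_node`
  this covers EVERY multiplicative place modulo the instantiation facts S15 (iii).

References (locators only; no new fact): [cite: SilvermanAEC2009, VII.2 Prop. 2.1 (PDF p. 167),
Exercise 3.5(a) (PDF p. 97), VII.§5 (PDF p. 174)] [cite: MilneADT2006, Ch. I Prop. 3.8]
[cite: SerreLocalFields1979, X §1 (Hilbert 90)] [cite: Jetchev2008, Prop. 4.1 (p. 819)].

## Design

No definitions; the torus is `AddSubgroup.zmultiples (Additive.ofMul ζ) ≤ Additive k'ˣ`, `r` is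
co-restricted to it (`AddMonoidHom.codRestrict`), `φ_C = (−q) •`. Axioms: `propext`,
`Classical.choice`, `Quot.sound`.
-/

noncomputable section

open scoped Classical

namespace Summit.BirchSwinnertonDyer.Rank1Residual.X11b.Three.JetchevKummer

open WeierstrassCurve Literature.NumberTheory.EllipticCurves

universe u

/-! ### §3 The stub `h1red` at a non-split node that stays non-split over `k` -/

section Nonsplit

variable {F : Type u} [Field F] (X : WeierstrassCurve F) (L : Type u) [Field L] [Algebra F L]
  (R : Type*) [CommRing R] [IsDomain R] [IsDiscreteValuationRing R] [Algebra R L]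
  [IsFractionRing R L] [(X.baseChange L).IsMinimal R]
  [HenselianRing R (IsLocalRing.maximalIdeal R)] [Finite (IsLocalRing.ResidueField R)]
  (W₀ : WeierstrassCurve R) (hX : X.baseChange L = W₀.baseChange L)
  {k' : Type*} [Field k'] (j : IsLocalRing.ResidueField R →+* k')

include hX in
/-- **The `Ẽ_ns` half of (α) at a NON-SPLIT node that stays non-split over `k`** (the stub
`h1red` of `hα_of_cyclic_of_halves` HOLDS for `E₁ = E₁(L)`; the case NOT covered by p4's
`h1red_of_node`). Hypotheses: every `τ ∈ Aut(L/F)` preserves `R` (`hR`); `W₀` an `R`-model of the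
`R`-minimal `X ⊗ L` (`hX`) whose reduction pushed along `j : k →+* k'` is
`singularModel x₀ y₀ α₁ α₂` (`hW`) with `α₁ ∉ j(k)` (`hα₁`: NON-split over `k`); `R` henselian,
`#k = qⁿ`; `φ ∈ Aut(L/F)` inducing `x ↦ x^q` on `k` (`hfrob`); on `k'` the `q`-power map is a
ring endomorphism `Fq` and `ζ ∈ k'ˣ` is a primitive `(qⁿ + 1)`-th root of unity. Conclusion:
every `m ∈ E₀(L)` with `Σ_{j<n} φʲ m = O` is `≡ φ c − c (mod E₁(L))` for some `c ∈ E₀(L)`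
(reduction onto the norm-one torus `⟨ζ⟩`, `r(φ P) = (r P)^{−q}`, `n` odd, Hilbert 90 in cyclic
form). Silverman *AEC* VII.2.1, Ex. 3.5(a). [cite: SilvermanAEC2009, VII.2 Prop. 2.1 and
Exercise 3.5(a) (PDF pp. 167, 97)] [cite: SerreLocalFields1979, X §1 (Hilbert 90)] -/
theorem h1red_of_nonsplit_node
    (hR : ∀ (τ : L ≃ₐ[F] L) (x : L), x ∈ Set.range (algebraMap R L) →
      τ x ∈ Set.range (algebraMap R L))
    {x₀ y₀ α₁ α₂ : k'}
    (hW : (W₀.map (IsLocalRing.residue R)).map j = singularModel x₀ y₀ α₁ α₂)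
    (hα₁ : α₁ ∉ Set.range j)
    (φ : L ≃ₐ[F] L) {q n : ℕ} (hcard : Nat.card (IsLocalRing.ResidueField R) = q ^ n)
    (hfrob : ∀ a : R, ∃ a' : R, algebraMap R L a' = φ (algebraMap R L a) ∧
      IsLocalRing.residue R a' = IsLocalRing.residue R a ^ q)
    (Fq : k' →+* k') (hFq : ∀ x, Fq x = x ^ q) {ζ : k'ˣ} (hζ : IsPrimitiveRoot ζ (q ^ n + 1)) :
    ∀ m ∈ (X.baseChange L).goodReductionSubgroup R, ∑ j ∈ Finset.range n, (φ ^ j) • m = 0 →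
      ∃ c ∈ (X.baseChange L).goodReductionSubgroup R, m - (φ • c - c) ∈
        {Q : (X.baseChange L).toAffine.Point | ∀ (x y : L)
          (h : (X.baseChange L).toAffine.Nonsingular x y), Q = .some x y h →
            x ∉ Set.range (algebraMap R L)} := by
  have hv := integers_valuationRing_valuation R L
  have hinj : Function.Injective (algebraMap R L) := IsFractionRing.injective R L
  haveI : Fintype (IsLocalRing.ResidueField R) := Fintype.ofFinite _
  have hcardF : Fintype.card (IsLocalRing.ResidueField R) = q ^ n := by
    rw [← Nat.card_eq_fintype_card, hcard]
  have hpow_k (t : IsLocalRing.ResidueField R) : t ^ q ^ n = t := by rw [← hcardF, FiniteField.pow_card]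
  have hiter : ∀ (m : ℕ) (x : k'), (⇑Fq)^[m] x = x ^ q ^ m := by
    intro m x
    induction m with
    | zero => simp
    | succ m ih => rw [Function.iterate_succ_apply', ih, hFq, ← pow_mul, ← pow_succ]
  have hFn : ∀ x : k', (Fq ^ n) x = x ^ q ^ n := fun x ↦ by rw [RingHom.coe_pow, hiter]
  have hFnj : ∀ t, (Fq ^ n) (j t) = j t := fun t ↦ by rw [hFn, ← map_pow, hpow_k]
  have hfixj : ∀ x : k', (Fq ^ n) x = x → x ∈ Set.range j := fun x hx ↦
    mem_range_of_pow_card_eq j x (by rw [hcardF, ← hFn, hx])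
  -- `F` fixes the presented node and swaps its slopes; `α₁ ≠ α₂`
  have hWF : (singularModel x₀ y₀ α₁ α₂).map (Fq ^ n) = singularModel x₀ y₀ α₁ α₂ := by
    rw [← hW, map_map, show (Fq ^ n).comp j = j from RingHom.ext hFnj]
  obtain ⟨hFx₀, hFy₀, hFslopes⟩ := singularModel.apply_eq_of_map_eq hWF
  have hF₁₂ : (Fq ^ n) α₁ = α₂ ∧ (Fq ^ n) α₂ = α₁ := hFslopes.resolve_left fun h ↦ hα₁ (hfixj α₁ h.1)
  have hα : α₁ ≠ α₂ := fun h ↦ hα₁ (hfixj α₁ (hF₁₂.1.trans h.symm))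
  -- (1) the node reduction map over `k'` and (2) its Galois rule for `(φ, Fq)`
  obtain ⟨r, hr0, hr⟩ := exists_addMonoidHom_units_of_map_map_eq_singularModel L R W₀ j hW hα
  obtain ⟨σk, hσres, hrest⟩ :=
    exists_residueMap_nodeReduction_smul_ext X L R W₀ hX j hR φ hW r hr0 hr
  have hσk : ∀ x : IsLocalRing.ResidueField R, σk x = x ^ q := by
    intro x
    obtain ⟨a, rfl⟩ := IsLocalRing.residue_surjective x
    obtain ⟨a', ha', hres⟩ := hfrob a
    rw [hσres a a' ha', hres]
  obtain ⟨-, -, hcases⟩ := hrest Fq (fun t ↦ by rw [hFq, hσk, map_pow])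
  -- `Fq` swaps the slopes (else `Fqⁿ` would fix `α₁`): the anti-equivariant case
  obtain ⟨hq₁, hq₂, hminus⟩ := hcases.resolve_left fun h ↦ hα (Eq.trans
    (by rw [RingHom.coe_pow]; exact (Function.iterate_fixed h.1 n).symm) hF₁₂.1)
  -- `n` is odd (`Fq` swaps the slopes, `Fqⁿ` swaps them)
  have hodd : Odd n := by
    refine (Nat.even_or_odd n).resolve_left fun ⟨m, hm⟩ ↦ hα (Eq.trans (Eq.symm ?_) hF₁₂.1)
    have h2 : (⇑Fq)^[2] α₁ = α₁ := show Fq (Fq α₁) = α₁ by rw [hq₁, hq₂]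
    rw [RingHom.coe_pow, hm, ← two_mul, Function.iterate_mul]
    exact Function.iterate_fixed h2 m
  -- (3) Galois rule for `(1, F)`: `r` lands in the norm-one torus
  obtain ⟨σk₁, hσres₁, hrest₁⟩ :=
    exists_residueMap_nodeReduction_smul_ext X L R W₀ hX j hR 1 hW r hr0 hr
  have hσk₁ : ∀ t : IsLocalRing.ResidueField R, σk₁ t = t := by
    intro t
    obtain ⟨a, rfl⟩ := IsLocalRing.residue_surjective t
    exact hσres₁ a a rfl
  obtain ⟨-, -, hcases₁⟩ := hrest₁ (Fq ^ n) (fun t ↦ by rw [hFnj, hσk₁])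
  have htorus : ∀ (P : (X.baseChange L).toAffine.Point)
      (hP : W₀.HasNonsingularReduction (Affine.Point.congrEquiv hX P)),
      (r ⟨_, hP⟩).toMul ^ (q ^ n + 1) = 1 := by
    intro P hP
    obtain ⟨-, -, hF⟩ := hcases₁.resolve_left fun h ↦ hα₁ (hfixj α₁ h.1)
    have hP1 : W₀.HasNonsingularReduction
        (Affine.Point.congrEquiv hX ((1 : L ≃ₐ[F] L) • P)) := by rwa [one_smul]
    have e : (⟨_, hP1⟩ : W₀.nonsingularReductionSubgroup hv) = ⟨_, hP⟩ :=
      Subtype.ext (congrArg (Affine.Point.congrEquiv hX) (one_smul (L ≃ₐ[F] L) P))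
    have h := hF P hP hP1
    rw [e, hFn, ← Units.val_pow_eq_pow_val, ← Units.val_inv_eq_inv_val] at h
    rw [pow_succ', ← eq_inv_iff_mul_eq_one]
    exact Units.ext h
  -- the torus `T = ⟨ζ⟩ ≤ k'ˣ` (additively) and its generator
  set T : AddSubgroup (Additive k'ˣ) := AddSubgroup.zmultiples (Additive.ofMul ζ)
  have hmemT : ∀ u : k'ˣ, u ^ (q ^ n + 1) = 1 → Additive.ofMul u ∈ T := by
    intro u hu
    obtain ⟨i, -, hi⟩ := hζ.eq_pow_of_mem_rootsOfUnity ((mem_rootsOfUnity _ u).mpr hu)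
    exact AddSubgroup.mem_zmultiples_iff.mpr ⟨i, by rw [← hi, ofMul_pow, natCast_zsmul]⟩
  let g : T := ⟨Additive.ofMul ζ, AddSubgroup.mem_zmultiples _⟩
  have hg : ∀ c : T, c ∈ AddSubgroup.zmultiples g := by
    intro c
    obtain ⟨z, hz⟩ := AddSubgroup.mem_zmultiples_iff.mp c.2
    exact AddSubgroup.mem_zmultiples_iff.mpr
      ⟨z, Subtype.ext (by rw [AddSubgroupClass.coe_zsmul]; exact hz)⟩
  have hN : addOrderOf g = q ^ n + 1 := by
    rw [← AddSubgroup.addOrderOf_coe, addOrderOf_ofMul_eq_orderOf, ← hζ.eq_orderOf]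
  -- the membership bridge and the transport `T₀ : E₀ (Tamagawa) → E₀ (ReductionHomomorphism)`
  have memiff := mem_goodReductionSubgroup_iff_hasNonsingularReduction_congrEquiv X L R W₀ hX
  let T₀ : (X.baseChange L).goodReductionSubgroup R →+ W₀.nonsingularReductionSubgroup hv :=
    { toFun := fun b ↦ ⟨Affine.Point.congrEquiv hX (b : (X.baseChange L).toAffine.Point),
        (memiff _).mp b.2⟩
      map_zero' := Subtype.ext (by simp only [AddSubgroup.coe_zero, map_zero])
      map_add' := fun a b ↦ Subtype.ext (by simp only [AddSubgroup.coe_add, map_add]) }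
  have hT₀ : ∀ b : (X.baseChange L).goodReductionSubgroup R,
      (T₀ b : (W₀.baseChange L).toAffine.Point) =
        Affine.Point.congrEquiv hX (b : (X.baseChange L).toAffine.Point) := fun _ ↦ rfl
  let r' : (X.baseChange L).goodReductionSubgroup R →+ Additive k'ˣ := r.comp T₀
  have hr' : ∀ b : (X.baseChange L).goodReductionSubgroup R, r' b = r (T₀ b) := fun _ ↦ rfl
  let φB : (X.baseChange L).goodReductionSubgroup R →+ (X.baseChange L).goodReductionSubgroup R :=
    { toFun := fun b ↦ ⟨φ • (b : (X.baseChange L).toAffine.Point),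
        smul_mem_goodReductionSubgroup X L R hR φ b.2⟩
      map_zero' := Subtype.ext (smul_zero φ)
      map_add' := fun a b ↦ Subtype.ext (smul_add φ _ _) }
  have hφB : ∀ b : (X.baseChange L).goodReductionSubgroup R,
      ((φB b : (X.baseChange L).goodReductionSubgroup R) : (X.baseChange L).toAffine.Point) =
      φ • (b : (X.baseChange L).toAffine.Point) := fun _ ↦ rfl
  -- values of `r'` on a point and on its `φ`-translate, at the level of `r`
  have hval : ∀ b : (X.baseChange L).goodReductionSubgroup R, ∃ (hP : W₀.HasNonsingularReduction
      (Affine.Point.congrEquiv hX (b : (X.baseChange L).toAffine.Point)))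
      (hσP : W₀.HasNonsingularReduction
        (Affine.Point.congrEquiv hX (φ • (b : (X.baseChange L).toAffine.Point)))),
      r' b = r ⟨_, hP⟩ ∧ r' (φB b) = r ⟨_, hσP⟩ :=
    fun b ↦ ⟨(memiff _).mp b.2, (memiff _).mp (φB b).2, rfl, rfl⟩
  -- `r'` lands in `T`; co-restrict it
  have hr'T : ∀ b, r' b ∈ T := by
    intro b
    obtain ⟨hP, -, e1, -⟩ := hval b
    rw [e1, ← ofMul_toMul (r ⟨_, hP⟩)]
    exact hmemT _ (htorus _ hP)
  let r'' : (X.baseChange L).goodReductionSubgroup R →+ T := r'.codRestrict T hr'T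
  have hr'' : ∀ b, ((r'' b : T) : Additive k'ˣ) = r' b := fun _ ↦ rfl
  -- the endomorphism `(−q) •` of `T` and the equivariance `r''(φ b) = (−q) • r'' b`
  let φC : T →+ T := DistribSMul.toAddMonoidHom T (-(q : ℤ))
  have hφC : ∀ c : T, φC c = (-(q : ℤ)) • c := fun _ ↦ rfl
  have hcomm : ∀ b, r'' (φB b) = φC (r'' b) := by
    intro b
    apply Subtype.ext
    rw [hφC, AddSubgroupClass.coe_zsmul, hr'', hr'']
    obtain ⟨hP, hσP, e1, e2⟩ := hval b
    rw [e2, e1]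
    apply Additive.toMul.injective
    apply Units.ext
    rw [toMul_zsmul, zpow_neg, zpow_natCast, Units.val_inv_eq_inv_val, Units.val_pow_eq_pow_val,
      ← hFq]
    exact hminus _ hP hσP
  -- `r''` is onto `T` (`ψ` bijective + Frobenius-fixed points are `k`-rational + Hensel)
  have hsurj : Function.Surjective r'' := by
    intro c
    set u : k'ˣ := Additive.toMul (c : Additive k'ˣ) with hudef
    have huT : u ^ (q ^ n + 1) = 1 := by
      obtain ⟨z, hz⟩ := AddSubgroup.mem_zmultiples_iff.mp c.2
      rw [hudef, ← hz, toMul_zsmul, toMul_ofMul, ← zpow_natCast, ← zpow_mul, mul_comm, zpow_mul,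
        zpow_natCast, hζ.pow_eq_one, one_zpow]
    suffices h : ∃ b, r' b = Additive.ofMul u by
      obtain ⟨b, hb⟩ := h
      exact ⟨b, Subtype.ext (by rw [hr'', hb, hudef, ofMul_toMul])⟩
    obtain ⟨Q, hQ⟩ := singularModel.nodeHom_surjective (x₀ := x₀) (y₀ := y₀) hα (Additive.ofMul u)
    rcases Q with _ | ⟨x, y, hns⟩
    · refine ⟨0, ?_⟩
      rw [map_zero, ← hQ]
      exact (map_zero _).symm
    · -- `F Q = Q`: `ψ(F Q) = F(ψ Q)⁻¹ = (u^{qⁿ})⁻¹ = u = ψ(Q)` and `ψ` is injective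
      have hψ : singularModel.nodeFun x₀ y₀ α₁ α₂ (.some x y hns) = (u : k') := by
        rw [← singularModel.coe_toMul_nodeHom, hQ, toMul_ofMul]
      have hval' : singularModel.nodeFun x₀ y₀ α₁ α₂ (mapPoint (Fq ^ n) hWF (.some x y hns)) =
          ((Fq ^ n) (singularModel.nodeFun x₀ y₀ α₁ α₂ (.some x y hns)))⁻¹ := by
        rw [mapPoint_some]
        simp only [singularModel.nodeFun, map_div₀, map_sub, map_mul, hFx₀, hFy₀, hF₁₂.1,
          hF₁₂.2, inv_div]
      have hu' : (u ^ q ^ n)⁻¹ = u :=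
        (eq_inv_of_mul_eq_one_right (by rw [← pow_succ]; exact huT)).symm
      have hu : ((Fq ^ n) (u : k'))⁻¹ = (u : k') := by
        rw [hFn, ← Units.val_pow_eq_pow_val, ← Units.val_inv_eq_inv_val, hu']
      have heqH : singularModel.nodeHom x₀ y₀ α₁ α₂ (mapPoint (Fq ^ n) hWF (.some x y hns)) =
          singularModel.nodeHom x₀ y₀ α₁ α₂ (.some x y hns) := by
        apply Additive.toMul.injective
        apply Units.ext
        rw [singularModel.coe_toMul_nodeHom, singularModel.coe_toMul_nodeHom, hval', hψ, hu]
      have hfixQ := singularModel.nodeHom_injective hα heqH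
      rw [mapPoint_some] at hfixQ
      obtain ⟨hxF, hyF⟩ := Affine.Point.some.inj hfixQ
      obtain ⟨xb, hxb⟩ := hfixj x hxF
      obtain ⟨yb, hyb⟩ := hfixj y hyF
      -- the `k`-rational non-singular point `(xb, yb)` of `W̃₀` and its Hensel lift
      have hnsj : (singularModel x₀ y₀ α₁ α₂).toAffine.Nonsingular (j xb) (j yb) := by
        rw [hxb, hyb]; exact hns
      have hns'' : ((W₀.map (IsLocalRing.residue R)).map j).toAffine.Nonsingular (j xb) (j yb) := by
        rw [hW]; exact hnsj
      have hnsk : (W₀.map (IsLocalRing.residue R)).toAffine.Nonsingular xb yb :=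
        (Affine.map_nonsingular _ j.injective _ _).mp hns''
      obtain ⟨a, b, heq, hxa, hya⟩ := W₀.exists_equation_residue_eq hnsk
      have hnsab : (W₀.map (IsLocalRing.residue R)).toAffine.Nonsingular (IsLocalRing.residue R a)
          (IsLocalRing.residue R b) := by rw [hxa, hya]; exact hnsk
      have h : (W₀.baseChange L).toAffine.Nonsingular (algebraMap R L a) (algebraMap R L b) :=
        W₀.nonsingular_baseChange_of_nonsingular_residue (K := L) heq hnsab
      have hP₀ : W₀.HasNonsingularReduction (.some _ _ h) :=
        (hasNonsingularReduction_some_algebraMap_iff hinj h).mpr hnsab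
      have hb₀ : (Affine.Point.congrEquiv hX).symm (.some _ _ h) ∈
          (X.baseChange L).goodReductionSubgroup R := by
        rw [memiff, AddEquiv.apply_symm_apply]
        exact hP₀
      refine ⟨⟨_, hb₀⟩, ?_⟩
      have hTb : T₀ ⟨_, hb₀⟩ = ⟨.some _ _ h, hP₀⟩ := Subtype.ext (AddEquiv.apply_symm_apply _ _)
      have hnsj' : (singularModel x₀ y₀ α₁ α₂).toAffine.Nonsingular (j (IsLocalRing.residue R a))
          (j (IsLocalRing.residue R b)) := by rw [hxa, hya]; exact hnsj
      rw [hr', hTb]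
      apply Additive.toMul.injective
      apply Units.ext
      rw [hr a b h hnsj' hP₀, toMul_ofMul, ← hψ]
      exact congrArg _ (point_some_congr (by rw [hxa, hxb]) (by rw [hya, hyb]))
  -- the kernel of `r''` consists of points reducing to `O`
  have hker : (r''.ker.map ((X.baseChange L).goodReductionSubgroup R).subtype :
      Set (X.baseChange L).toAffine.Point) ⊆
      {Q : (X.baseChange L).toAffine.Point | ∀ (x y : L)
        (h : (X.baseChange L).toAffine.Nonsingular x y), Q = .some x y h →
          x ∉ Set.range (algebraMap R L)} := by
    rintro _ ⟨b, hb, rfl⟩ x y h hbxy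
    have hb' : r (T₀ b) = 0 := congrArg Subtype.val (show r'' b = 0 from hb)
    have h0 := (hr0 (T₀ b)).mp hb'
    rw [hT₀, AddSubgroup.subtype_apply] at *
    rw [hbxy, Affine.Point.congrEquiv_some] at h0
    exact h0
  -- Hilbert 90 on the torus (`n` odd) and the dévissage along `r''`
  have hS : (∑ j ∈ Finset.range n, (-(q : ℤ)) ^ j) * (-(q : ℤ) - 1) = -((q ^ n + 1 : ℕ) : ℤ) := by
    rw [sum_neg_pow_mul_of_odd (q : ℤ) hodd]; push_cast; ring
  intro m hm hs
  obtain ⟨c, hcB, hc⟩ := h1red_of_reductionMap ((X.baseChange L).goodReductionSubgroup R)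
    φB hφB φC r'' hsurj hcomm
    (cyclicH1_zsmul_of_cyclic_of_eq_neg g hg hN (Nat.succ_pos _) φC hφC hS) m hm hs
  exact ⟨c, hcB, hker hc⟩

include hX in
/-- **(α) from the formal-group stub alone, at a non-split node that stays non-split over `k`.**
Under the hypotheses of `h1red_of_nonsplit_node` and with `Gal(L/F) = ⟨φ⟩`, `φⁿ = 1`: if the
formal-group half `h1ker` holds on `E₁(L)` (printed: `H¹(Gal, Ê(𝔪_L)) = 0` by successive
approximation, Milne *ADT* I.3.8 proof — NAMED STUB, x11b3-p4 S15 (i)), then p1's hypothesis `hα`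
holds: every `Q ∈ E(L)` with all `σ Q − Q ∈ E₀(L)` is congruent modulo `E₀(L)` to a
`Gal(L/F)`-fixed point. Companion of p4's `hα_of_h1ker_of_node`.
[cite: MilneADT2006, Ch. I Prop. 3.8] [cite: SilvermanAEC2009, VII.2 Prop. 2.1, Exercise 3.5(a)] -/
theorem hα_of_h1ker_of_nonsplit_node
    (hR : ∀ (τ : L ≃ₐ[F] L) (x : L), x ∈ Set.range (algebraMap R L) →
      τ x ∈ Set.range (algebraMap R L))
    {x₀ y₀ α₁ α₂ : k'}
    (hW : (W₀.map (IsLocalRing.residue R)).map j = singularModel x₀ y₀ α₁ α₂)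
    (hα₁ : α₁ ∉ Set.range j)
    (φ : L ≃ₐ[F] L) (hφ : ∀ σ : L ≃ₐ[F] L, σ ∈ Subgroup.zpowers φ) {q n : ℕ} (hn : φ ^ n = 1)
    (hcard : Nat.card (IsLocalRing.ResidueField R) = q ^ n)
    (hfrob : ∀ a : R, ∃ a' : R, algebraMap R L a' = φ (algebraMap R L a) ∧
      IsLocalRing.residue R a' = IsLocalRing.residue R a ^ q)
    (Fq : k' →+* k') (hFq : ∀ x, Fq x = x ^ q) {ζ : k'ˣ} (hζ : IsPrimitiveRoot ζ (q ^ n + 1))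
    (h1ker : ∀ m ∈ {Q : (X.baseChange L).toAffine.Point | ∀ (x y : L)
        (h : (X.baseChange L).toAffine.Nonsingular x y), Q = .some x y h →
          x ∉ Set.range (algebraMap R L)},
      ∑ j ∈ Finset.range n, (φ ^ j) • m = 0 →
        ∃ P ∈ {Q : (X.baseChange L).toAffine.Point | ∀ (x y : L)
          (h : (X.baseChange L).toAffine.Nonsingular x y), Q = .some x y h →
            x ∉ Set.range (algebraMap R L)}, φ • P - P = m) :
    ∀ Q : (X.baseChange L).toAffine.Point,
      (∀ σ : L ≃ₐ[F] L, σ • Q - Q ∈ (X.baseChange L).goodReductionSubgroup R) →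
        ∃ Q' : (X.baseChange L).toAffine.Point, (∀ σ : L ≃ₐ[F] L, σ • Q' = Q') ∧
          Q - Q' ∈ (X.baseChange L).goodReductionSubgroup R :=
  hα_of_cyclic_of_halves X L R φ hφ hn _
    (fun Q hQ ↦ mem_goodReductionSubgroup_of_reducesToZero X L R Q hQ) h1ker
    (h1red_of_nonsplit_node X L R W₀ hX j hR hW hα₁ φ hcard hfrob Fq hFq hζ)

include hX in
/-- **End form at `v` from the formal-group stub alone, at a non-split node that stays non-split
over `k`**: p4's `exists_baseChange_eq_add_pow_smul` (part 2) with `hstab` discharged from `hR`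
and (α) replaced by `h1ker` via `hα_of_h1ker_of_nonsplit_node`: `T = ι(t₀ + p^m t₁)` with
`t₀ ∈ E₀(K_v)`, i.e. `T ∈ E₀(K_v) + p^m E(K_v)` — Jetchev's Prop. 4.1 at `v`, modulo p1's inputs
(a), (b), the cocycle and the ONE remaining stub `h1ker`. Companion of p4's
`exists_baseChange_eq_add_pow_smul_of_h1ker_of_node`. [cite: Jetchev2008, Prop. 4.1 (p. 819)]
[cite: MilneADT2006, Ch. I Prop. 3.8] -/
theorem exists_baseChange_eq_add_pow_smul_of_h1ker_of_nonsplit_node [IsGalois F L]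
    (R₀ : Type*) [CommRing R₀] [IsDomain R₀] [IsDiscreteValuationRing R₀] [Algebra R₀ F]
    [IsFractionRing R₀ F] [Algebra R₀ R] [Algebra R₀ L] [IsScalarTower R₀ R L]
    [IsScalarTower R₀ F L] [IsLocalHom (algebraMap R₀ R)] [(X.baseChange F).IsMinimal R₀]
    (hR : ∀ (τ : L ≃ₐ[F] L) (x : L), x ∈ Set.range (algebraMap R L) →
      τ x ∈ Set.range (algebraMap R L))
    {x₀ y₀ α₁ α₂ : k'}
    (hW : (W₀.map (IsLocalRing.residue R)).map j = singularModel x₀ y₀ α₁ α₂)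
    (hα₁ : α₁ ∉ Set.range j)
    (φ : L ≃ₐ[F] L) (hφ : ∀ σ : L ≃ₐ[F] L, σ ∈ Subgroup.zpowers φ) {q n : ℕ} (hn : φ ^ n = 1)
    (hcard : Nat.card (IsLocalRing.ResidueField R) = q ^ n)
    (hfrob : ∀ a : R, ∃ a' : R, algebraMap R L a' = φ (algebraMap R L a) ∧
      IsLocalRing.residue R a' = IsLocalRing.residue R a ^ q)
    (Fq : k' →+* k') (hFq : ∀ x, Fq x = x ^ q) {ζ : k'ˣ} (hζ : IsPrimitiveRoot ζ (q ^ n + 1))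
    (h1ker : ∀ m ∈ {Q : (X.baseChange L).toAffine.Point | ∀ (x y : L)
        (h : (X.baseChange L).toAffine.Nonsingular x y), Q = .some x y h →
          x ∉ Set.range (algebraMap R L)},
      ∑ j ∈ Finset.range n, (φ ^ j) • m = 0 →
        ∃ P ∈ {Q : (X.baseChange L).toAffine.Point | ∀ (x y : L)
          (h : (X.baseChange L).toAffine.Nonsingular x y), Q = .some x y h →
            x ∉ Set.range (algebraMap R L)}, φ • P - P = m)
    {p m n' : ℕ} (hcop : Nat.Coprime n' (p ^ m)) {U P T : (X.baseChange L).toAffine.Point}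
    {Rσ : (L ≃ₐ[F] L) → (X.baseChange L).toAffine.Point}
    (hT : ∀ σ : L ≃ₐ[F] L, σ • T = T)
    (hP : (n' : ℤ) • P ∈ (X.baseChange L).goodReductionSubgroup R)
    (hRσ : ∀ σ : L ≃ₐ[F] L, (n' : ℤ) • Rσ σ ∈ (X.baseChange L).goodReductionSubgroup R)
    (hU : ∀ σ : L ≃ₐ[F] L, σ • U - U = Rσ σ) (hpU : ((p ^ m : ℕ) : ℤ) • U = P - T) :
    ∃ t₀ t₁ : (X.baseChange F).toAffine.Point,
      t₀ ∈ (X.baseChange F).goodReductionSubgroup R₀ ∧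
      T = Affine.Point.baseChange (W' := X.toAffine) F L (t₀ + ((p ^ m : ℕ) : ℤ) • t₁) :=
  exists_baseChange_eq_add_pow_smul X L R₀ R
    (fun σ _ hQ ↦ smul_mem_goodReductionSubgroup X L R hR σ hQ)
    (hα_of_h1ker_of_nonsplit_node X L R W₀ hX j hR hW hα₁ φ hφ hn hcard hfrob Fq hFq hζ h1ker)
    hcop hT hP hRσ hU hpU

end Nonsplit

end Summit.BirchSwinnertonDyer.Rank1Residual.X11b.Three.JetchevKummer

end
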